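import Summits.CriticalPhenomena.Ising3DConformalLimit.Theses.AnomalousForcesInteraction
import HarnessLib

/-!
# `AnomalousForcesInteraction.Assembly` (item stmt-CriticalPhenomena-2603), proved

THEOREM-ONLY file (no definitions, no named facts). The assembly item of route
`AnomalousForcesInteraction` of the sub-problem `Ising3DConformalLimit`:

`EtaPositive → GaussianLimitIsFree → DeltaLowerBound → MoebiusLimit → Ising3DConformalLimit`.

Proof (pure logic plus `linarith`, the route's own assembly sketch): take the witness `(ρ, Δ, S)`
of `MoebiusLimit`; it only remains to show `HasNontrivialU4 S`. If not, `GaussianLimitIsFree`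
(fed translation invariance and scale covariance read off Möbius covariance) gives `Δ = 1/2`,
while `EtaPositive` supplies `κ > 0`, `C` with `⟨σ₀σ_x⟩ ≤ C‖x‖^{-(1+κ)}` and `DeltaLowerBound`
(with `a := 1 + κ`) gives `1 + κ ≤ 2Δ = 1`, contradicting `κ > 0`.

No literature input beyond the definitions (`IsMoebiusCovariant.isEuclideanInvariant`,
`IsMoebiusCovariant.isScaleCovariant` of `Literature/Probability/LatticeModels/ConformalCovariance.lean`).
-/

namespace Summit.CriticalPhenomena.Ising3DConformalLimit.Theorems

open Literature.Probability.LatticeModels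
open Summit.CriticalPhenomena.Ising3DConformalLimit.Theses

/-- **`Assembly` (item stmt-CriticalPhenomena-2603 of route `AnomalousForcesInteraction`), proved**:
`EtaPositive → GaussianLimitIsFree → DeltaLowerBound → MoebiusLimit → Ising3DConformalLimit`.
Take the Möbius-covariant non-degenerate pointwise limit `(ρ, Δ, S)` of `MoebiusLimit`; clause
(iii) `HasNontrivialU4 S` is forced by contradiction: `U₄ ≡ 0` gives `Δ = 1/2`
(`GaussianLimitIsFree`, with translation invariance and scale covariance read off
`IsMoebiusCovariant`), whereas `EtaPositive` (exponent `1 + κ`, `κ > 0`) and `DeltaLowerBound`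
(`a := 1 + κ`) give `1 + κ ≤ 2Δ = 1`. Settles item stmt-CriticalPhenomena-2603 (exact signature).
[folklore] -/
theorem anomalousForcesInteraction_assembly_proof : AnomalousForcesInteraction.Assembly := by
  unfold AnomalousForcesInteraction.Assembly
  intro hAP hGF hDL hML
  -- (ML): the Möbius-covariant, non-degenerate pointwise limit (ρ, Δ, S)
  obtain ⟨ρ, Δ, S, hρ, hΔ, hlim, hnd, hM⟩ := hML
  refine ⟨ρ, Δ, S, hρ, hΔ, hlim, hnd, hM, ?_⟩
  -- clause (iii) by contradiction
  by_contra hU4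
  obtain ⟨κ, C, hκ, hbound⟩ := hAP
  have hhalf : Δ = 1 / 2 :=
    hGF ρ Δ S hρ hlim hnd hM.isEuclideanInvariant.1 hM.isScaleCovariant hU4
  have hle : 1 + κ ≤ 2 * Δ :=
    hDL (1 + κ) C ρ Δ S hbound hρ hlim hnd hM.isScaleCovariant
  linarith

end Summit.CriticalPhenomena.Ising3DConformalLimit.Theorems
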